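import Literature.Geometry.Lorentzian.KerrSchildMultiplierEnergyIdentity
import Literature.Geometry.Lorentzian.KerrSchildTruncatedCurrent
import Literature.Geometry.Lorentzian.KerrDomainOfDependence
import Summits.FinalStateConjecture.FinalStateConjecture.Theorems.ClusterCompletenessAdiabaticMultiKerrILEDTEnergyFluxSigns
import Summits.FinalStateConjecture.FinalStateConjecture.Theorems.ClusterCompletenessAdiabaticMultiKerrILEDTailsCutStationary

/-!
# Route ClusterCompleteness — crux `AdiabaticMultiKerrILED`, line `Sketch`:
# the weighted Killing current `W · J^T[Φ]` of the rest-frame tails-cut zone, pointwise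

Helper file for the crux `stmt-FinalStateConjecture-14310`
(`Summit.FinalStateConjecture.FinalStateConjecture.Theses.ClusterCompleteness.AdiabaticMultiKerrILED`),
line `Sketch`, stubs `sum_fderiv_weightedTCurrent_nonneg` (main), `contDiff_weightedTCurrent` and
`tailsCut_horizonFactor_flux_nonneg` (lead c7, wave 2).

Setting (one zone, zero spin, rest frame): the coefficient field is the tails-cut Kerr–Schild field
`G₀ = η⁻¹ − φ ℓ♯ ⊗ ℓ♯ = KerrSchild.inverseMetric φ (Kerr.nullVector 0)` with the profile
`φ(y) = χ(2 − r(y)/(8M)) · 2H(y)` (`χ = Real.smoothTransition`; Schwarzschild for `r ≤ 8M`, flat for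
`r ≥ 16M`, stationary), the multiplier is the Killing field `T = ∂₀ = KerrSchild.timeField` with
current `(J^T)^μ = KerrSchild.multiplierCurrent G₀ T Φ` (sign convention: `(J^T)⁰ = −`energy
density), and the weight is `W = χ(u₂/ε − 1) · χ(u₁)` with the receding horizon function
`u₂ = Kerr.horizonFn M 0 = (r − 2M) e^{−x⁰/(2M)}` and the cone function `u₁ = Kerr.coneFn A c`.
This file proves the three POINTWISE facts about `W · J^T[Φ]` that the weighted graph energy
inequality consumes:

* `tailsCut_horizonFactor_flux_nonneg` — **the receding horizon factor has the good sign at every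
  point `r > 2M` of the tails-cut field**: `0 ≤ ∑_μ ∂_μ[χ(u₂/ε − 1)] (J^T)^μ`. For `r ≤ 8M` the
  profile is `2H` at the point and this is the landed exact-Schwarzschild lemma
  `sum_fderiv_horizonFactor_mul_multiplierCurrent_timeField_nonneg`; for `r > 8M` one has
  `d[χ(u₂/ε − 1)] = −k ν`, `k ≥ 0`, `ν = (s, −∇r)`, `s = (r − 2M)/(2M) ≥ 1 = |∇r|`, so `ν` is
  `G₀`-causal with `ν₀ > 0` and the dominant energy condition
  (`neg_sum_multiplierCurrent_timeField_mul_nonneg_of_causal`, `0 ≤ φ ≤ 2M/r < 1`) signs the flux;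
* `sum_fderiv_weightedTCurrent_nonneg` — **`∑_μ ∂_μ (W (J^T)^μ) ≥ 0` at points `r > 2M`, `x⁰ < A`
  where `□_{G₀} Φ = 0`**: by Leibniz, `∑ ∂(W J) = W ∑ ∂_μ (J^T)^μ + χ(u₂/ε−1) ∑ ∂[χ∘u₁] J^T
  + χ(u₁) ∑ ∂[χ(u₂/ε−1)] J^T`; the first term vanishes (`KerrSchild.sum_fderiv_multiplierCurrent`:
  `∑ ∂_μ (J^T)^μ = (□Φ) T(Φ) + K^T`, `□Φ = 0`, `K^T = 0` by stationarity,
  `multiplierBulk_timeField_tailsCut_eq_zero`), the other two are `≥ 0` by the cone-factor sign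
  `sum_fderiv_coneFactor_mul_multiplierCurrent_timeField_nonneg` and the horizon-factor sign above,
  times the non-negative weights;
* `contDiff_weightedTCurrent` — **`W (J^T)^μ ∈ C¹(ℝ⁴)` for `Φ ∈ C²(ℝ⁴)`**: off `{r ≤ M}` all factors
  are `C¹` (`G₀` is smooth on `{r > 0}`, `contDiffAt_tailsCut_inverseMetric`;
  `KerrSchild.contDiffAt_multiplierCurrent`), and on `{r < 2M}` the horizon factor, hence the
  product, vanishes identically (`Kerr.contDiff_of_eq_zero_of_radius_lt`).

Hawking–Ellis 1973, §4.3 (dominant energy condition, Lemma 4.3.1); Dafermos–Rodnianski–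
Shlapentokh-Rothman arXiv:1402.7034, §2.3.1–§2.3.2 (the `T`-energy identity, `K^T = 0`, signs of
the boundary terms). [folklore]
-/

noncomputable section

-- the doubled `FinalStateConjecture.FinalStateConjecture` path component trips dupNamespace
set_option linter.dupNamespace false

open Set Filter
open scoped BigOperators Topology
open Literature.Geometry.Lorentzian

namespace Summit.FinalStateConjecture.FinalStateConjecture.Theorems

/-! ### The smooth step `χ = Real.smoothTransition` (local copies of private Literature facts) -/

/-- `χ' ≥ 0` (`χ` is monotone). [folklore] -/
private theorem weightedT_deriv_smoothTransition_nonneg (s : ℝ) :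
    0 ≤ deriv Real.smoothTransition s :=
  Real.smoothTransition.monotone.deriv_nonneg

/-- `χ` is differentiable, with derivative `χ'`. [folklore] -/
private theorem weightedT_hasDerivAt_smoothTransition (s : ℝ) :
    HasDerivAt Real.smoothTransition (deriv Real.smoothTransition s) s :=
  ((Real.smoothTransition.contDiffAt (n := 1)).differentiableAt (by simp)).hasDerivAt

/-! ### Zero-spin facts: `|∇r| = 1` and `0 ≤ φ < 1` for the tails-cut profile -/

/-- For `a = 0` the spatial gradient of the Kerr–Schild radius is a Euclidean unit vector wherever
`r > 0`: `|∇r|² Σ = r² + a²` (`Kerr.sum_sq_radiusGradVec_mul_blSigma`) with `Σ = r²` for `a = 0`.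
[folklore] -/
theorem weightedT_sum_sq_radiusGradVec_zero {x : E4} (hx : 0 < Kerr.radius 0 x) :
    Kerr.radiusGradVec 0 (E4.spatial x) 0 ^ 2 + Kerr.radiusGradVec 0 (E4.spatial x) 1 ^ 2 +
      Kerr.radiusGradVec 0 (E4.spatial x) 2 ^ 2 = 1 := by
  have h := Kerr.sum_sq_radiusGradVec_mul_blSigma hx
  have hSig : Kerr.blSigma 0 (E4.spatial x) = Kerr.radius 0 x ^ 2 := by
    rw [Kerr.blSigma_spatial_eq, Kerr.radius_zero_left]
    ring
  rw [hSig] at h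
  have hr2 : (0 : ℝ) < Kerr.radius 0 x ^ 2 := by positivity
  have h' : (Kerr.radiusGradVec 0 (E4.spatial x) 0 ^ 2 + Kerr.radiusGradVec 0 (E4.spatial x) 1 ^ 2 +
      Kerr.radiusGradVec 0 (E4.spatial x) 2 ^ 2) * Kerr.radius 0 x ^ 2 = 1 * Kerr.radius 0 x ^ 2 := by
    rw [h]
    ring
  exact (mul_left_inj' hr2.ne').1 h'

/-- The tails-cut profile `χ(2 − r/(8M)) · 2H` is non-negative for `M ≥ 0` (`χ ≥ 0`, `H ≥ 0`).
[folklore] -/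
theorem weightedT_profile_nonneg {M : ℝ} (hM : 0 ≤ M) (a : ℝ) (x : E4) :
    0 ≤ Real.smoothTransition (2 - Kerr.radius a x / (8 * M)) * (2 * Kerr.scalarH M a x) :=
  mul_nonneg (Real.smoothTransition.nonneg _)
    (mul_nonneg zero_le_two (Kerr.scalarH_nonneg hM a x))

/-- The tails-cut profile is `< 1` off `{r ≤ 2M}` (`M ≥ 0`): `χ ≤ 1` and `2H ≤ 2M/r < 1`
(`Kerr.scalarH_le_div`), i.e. `T = ∂₀` is timelike there. [folklore] -/
theorem weightedT_profile_lt_one {M a : ℝ} (hM : 0 ≤ M) {x : E4} (hx : 2 * M < Kerr.radius a x) :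
    Real.smoothTransition (2 - Kerr.radius a x / (8 * M)) * (2 * Kerr.scalarH M a x) < 1 := by
  have hxpos : 0 < Kerr.radius a x := lt_of_le_of_lt (by positivity) hx
  have hH : Kerr.scalarH M a x ≤ M / Kerr.radius a x := Kerr.scalarH_le_div hM a hxpos
  have hMr : M / Kerr.radius a x < 1 / 2 := by
    rw [div_lt_iff₀ hxpos]
    linarith
  have h2H : 2 * Kerr.scalarH M a x < 1 := by linarith
  exact mul_lt_one_of_nonneg_of_lt_one_right (Real.smoothTransition.le_one _)
    (mul_nonneg zero_le_two (Kerr.scalarH_nonneg hM a x)) h2H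

/-! ### Leibniz for the weighted current -/

/-- **Leibniz rule for the weighted current, summed over the coordinate directions**: at a point
where `W₁`, `W₂` and the components `J^μ` are differentiable,
`∑_μ ∂_μ (W₁ W₂ J^μ) = W₁ W₂ ∑_μ ∂_μ J^μ + W₁ ∑_μ (∂_μ W₂) J^μ + W₂ ∑_μ (∂_μ W₁) J^μ`. [folklore] -/
theorem weightedT_sum_fderiv_mul_mul {W₁ W₂ : E4 → ℝ} {J : Fin 4 → E4 → ℝ} {x : E4}
    (h₁ : DifferentiableAt ℝ W₁ x) (h₂ : DifferentiableAt ℝ W₂ x)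
    (hJ : ∀ μ, DifferentiableAt ℝ (J μ) x) :
    ∑ μ, fderiv ℝ (fun y ↦ W₁ y * W₂ y * J μ y) x (E4.basisVector μ) =
      W₁ x * W₂ x * ∑ μ, fderiv ℝ (J μ) x (E4.basisVector μ) +
        W₁ x * ∑ μ, fderiv ℝ W₂ x (E4.basisVector μ) * J μ x +
        W₂ x * ∑ μ, fderiv ℝ W₁ x (E4.basisVector μ) * J μ x := by
  have hd : ∀ μ, HasFDerivAt (fun y ↦ W₁ y * W₂ y * J μ y)
      ((W₁ x * W₂ x) • fderiv ℝ (J μ) x +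
        J μ x • (W₁ x • fderiv ℝ W₂ x + W₂ x • fderiv ℝ W₁ x)) x :=
    fun μ ↦ (h₁.hasFDerivAt.mul h₂.hasFDerivAt).mul (hJ μ).hasFDerivAt
  simp only [fun μ ↦ (hd μ).fderiv, add_apply, smul_apply, smul_eq_mul, Fin.sum_univ_four]
  ring

/-! ### The registered stubs -/

/-- **The receding horizon factor has the good sign on the whole tails-cut zone `{r > 2M}`**
(`a = 0`, `M > 0`, `ε > 0`): for `W = χ(u₂/ε − 1)`, `u₂ = Kerr.horizonFn M 0`, the tails-cut
Kerr–Schild field `G₀ = η⁻¹ − χ(2 − r/8M) 2H ℓ♯ ⊗ ℓ♯` and every `w`,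
`0 ≤ ∑_μ ∂_μW(x) (J^T)^μ(x)`. On `{r ≤ 8M}` the profile is `2H` at `x`
(`tailsCut_profile_eq_of_radius_le`) and this is
`sum_fderiv_horizonFactor_mul_multiplierCurrent_timeField_nonneg`; on `{r > 8M}` one has
`dW = −k ν`, `k = χ' e^{−x⁰/2M}/ε ≥ 0`, `ν = (s, −∇r)` with `s = (r − 2M)/(2M) ≥ 1 = |∇r|`, a
`G₀`-causal covector with `ν₀ > 0` (`|ν⃗|² = 1 ≤ s² + φ (s − ℓ⃗·ν⃗)²`), and `0 ≤ φ(x) < 1`, so the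
dominant energy condition `neg_sum_multiplierCurrent_timeField_mul_nonneg_of_causal` gives
`−∑ (J^T)^μ ν_μ ≥ 0`. DRSR arXiv:1402.7034, §2.3.2; Hawking–Ellis 1973, §4.3. [folklore] -/
theorem tailsCut_horizonFactor_flux_nonneg : ∀ (M ε : ℝ) (w : E4 → ℝ) (x : E4), 0 < M → 0 < ε → 2 * M < Kerr.radius 0 x → 0 ≤ ∑ μ, fderiv ℝ (fun y ↦ Real.smoothTransition (Kerr.horizonFn M 0 y / ε - 1)) x (E4.basisVector μ) * KerrSchild.multiplierCurrent (KerrSchild.inverseMetric (fun y ↦ Real.smoothTransition (2 - Kerr.radius 0 y / (8 * M)) * (2 * Kerr.scalarH M 0 y)) (Kerr.nullVector 0)) KerrSchild.timeField w x μ := by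
  intro M ε w x hM hε hx
  rcases le_or_gt (Kerr.radius 0 x) (8 * M) with h8 | h8
  · -- exact Schwarzschild region: the landed lemma with `φ :=` the tails-cut profile
    exact sum_fderiv_horizonFactor_mul_multiplierCurrent_timeField_nonneg M _ w ε x hM hε hx
      (tailsCut_profile_eq_of_radius_le M 0 x hM h8)
  · -- far from the horizon: `ν = (s, −∇r)`, `s = (r − 2M)/(2M) ≥ 1 = |∇r|`
    have hxpos : 0 < Kerr.radius 0 x := lt_trans (by positivity) hx
    have h2M : (0 : ℝ) < 2 * M := by positivity
    have hrp : Kerr.rPlus M 0 = 2 * M := Kerr.rPlus_zero_right hM.le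
    set s : ℝ := (Kerr.radius 0 x - 2 * M) / (2 * M) with hs
    have hs1 : 1 ≤ s := by
      rw [hs, le_div_iff₀ h2M]
      linarith
    have hs0 : 0 < s := lt_of_lt_of_le one_pos hs1
    set ν : Fin 4 → ℝ := ![s, -Kerr.radiusGradVec 0 (E4.spatial x) 0,
      -Kerr.radiusGradVec 0 (E4.spatial x) 1, -Kerr.radiusGradVec 0 (E4.spatial x) 2] with hν
    have hν0 : ν 0 = s := rfl
    have hν1 : ν 1 = -Kerr.radiusGradVec 0 (E4.spatial x) 0 := rfl
    have hν2 : ν 2 = -Kerr.radiusGradVec 0 (E4.spatial x) 1 := rfl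
    have hν3 : ν 3 = -Kerr.radiusGradVec 0 (E4.spatial x) 2 := rfl
    -- the Kerr–Schild data at `x`: `l⁰ = −1`, `|l⃗| = 1`, `0 ≤ φ < 1`
    have hl0 : Kerr.nullVector 0 x 0 = -1 := Kerr.nullVector_apply_zero 0 x
    have hL : Kerr.nullVector 0 x 1 ^ 2 + Kerr.nullVector 0 x 2 ^ 2 + Kerr.nullVector 0 x 3 ^ 2 =
        1 := by
      rw [Kerr.nullVector_apply_one, Kerr.nullVector_apply_two, Kerr.nullVector_apply_three]
      exact Kerr.sum_sq_nullCovectorFun hxpos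
    have hφ0 := weightedT_profile_nonneg hM.le 0 x
    have hφ1 := (weightedT_profile_lt_one hM.le hx).le
    -- `ν` is causal: `|ν⃗|² = 1 ≤ s² ≤ s² + φ (s − ℓ⃗·ν⃗)²`
    have hn : ν 1 ^ 2 + ν 2 ^ 2 + ν 3 ^ 2 ≤ ν 0 ^ 2 +
        Real.smoothTransition (2 - Kerr.radius 0 x / (8 * M)) * (2 * Kerr.scalarH M 0 x) *
          (ν 0 - (Kerr.nullVector 0 x 1 * ν 1 + Kerr.nullVector 0 x 2 * ν 2 +
            Kerr.nullVector 0 x 3 * ν 3)) ^ 2 :=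
      calc ν 1 ^ 2 + ν 2 ^ 2 + ν 3 ^ 2 = 1 := by
            rw [hν1, hν2, hν3, neg_sq, neg_sq, neg_sq]
            exact weightedT_sum_sq_radiusGradVec_zero hxpos
        _ ≤ ν 0 ^ 2 := by rw [hν0]; nlinarith [hs1]
        _ ≤ _ := le_add_of_nonneg_right (mul_nonneg hφ0 (sq_nonneg _))
    -- the dominant energy condition: `0 ≤ −∑ (J^T)^μ ν_μ`
    have hflux := neg_sum_multiplierCurrent_timeField_mul_nonneg_of_causal
      (fun y ↦ Real.smoothTransition (2 - Kerr.radius 0 y / (8 * M)) * (2 * Kerr.scalarH M 0 y))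
      (Kerr.nullVector 0) w x ν hφ1 hl0 hL (by rw [hν0]; exact hs0) hn
    -- the derivative of the factor is `−k ν`, `k ≥ 0`
    have hdiff : HasFDerivAt (Kerr.horizonFn M 0) (fderiv ℝ (Kerr.horizonFn M 0) x) x :=
      ((Kerr.contDiffAt_horizonFn M hxpos (n := 1)).differentiableAt (by simp)).hasFDerivAt
    have haff : HasDerivAt (fun u : ℝ ↦ u / ε - 1) (1 / ε) (Kerr.horizonFn M 0 x) :=
      ((hasDerivAt_id _).div_const ε).sub_const 1
    have hd : HasFDerivAt (fun y ↦ Real.smoothTransition (Kerr.horizonFn M 0 y / ε - 1))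
        ((deriv Real.smoothTransition (Kerr.horizonFn M 0 x / ε - 1) * (1 / ε)) •
          fderiv ℝ (Kerr.horizonFn M 0) x) x :=
      ((weightedT_hasDerivAt_smoothTransition _).comp _ haff).comp_hasFDerivAt x hdiff
    set k : ℝ := deriv Real.smoothTransition (Kerr.horizonFn M 0 x / ε - 1) * (1 / ε) *
      Real.exp (-((2 * M)⁻¹ * x 0)) with hk
    have hk0 : 0 ≤ k :=
      mul_nonneg (mul_nonneg (weightedT_deriv_smoothTransition_nonneg _) (by positivity))
        (Real.exp_pos _).le
    have e0 : fderiv ℝ (fun y ↦ Real.smoothTransition (Kerr.horizonFn M 0 y / ε - 1)) x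
        (E4.basisVector 0) = -(k * ν 0) := by
      rw [hd.fderiv, FunLike.coe_smul, Pi.smul_apply, smul_eq_mul,
        Kerr.fderiv_horizonFn_basisVector_zero hxpos, hrp, hν0, hk, hs]
      ring
    have es : ∀ i : Fin 3, fderiv ℝ (fun y ↦ Real.smoothTransition (Kerr.horizonFn M 0 y / ε - 1))
        x (E4.basisVector i.succ) = -(k * -Kerr.radiusGradVec 0 (E4.spatial x) i) := by
      intro i
      rw [hd.fderiv, FunLike.coe_smul, Pi.smul_apply, smul_eq_mul,
        Kerr.fderiv_horizonFn_basisVector_succ hxpos, hk]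
      ring
    have e1 : fderiv ℝ (fun y ↦ Real.smoothTransition (Kerr.horizonFn M 0 y / ε - 1)) x
        (E4.basisVector 1) = -(k * ν 1) := es 0
    have e2 : fderiv ℝ (fun y ↦ Real.smoothTransition (Kerr.horizonFn M 0 y / ε - 1)) x
        (E4.basisVector 2) = -(k * ν 2) := es 1
    have e3 : fderiv ℝ (fun y ↦ Real.smoothTransition (Kerr.horizonFn M 0 y / ε - 1)) x
        (E4.basisVector 3) = -(k * ν 3) := es 2
    rw [Fin.sum_univ_four] at hflux ⊢
    rw [e0, e1, e2, e3]
    have hkf := mul_nonneg hk0 hflux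
    linarith

/-- **The weighted Killing current has non-negative divergence at the regular points of a
solution**: for the tails-cut zero-spin zone (`M > 0`), `ε > 0`, a point `x` with `x⁰ < A` and
`r(x) > 2M`, and `Φ` of class `C²` at `x` with `□_{G₀} Φ (x) = 0`,
`0 ≤ ∑_μ ∂_μ (W (J^T)^μ)(x)`, `W = χ(u₂/ε − 1) χ(u₁)`. By Leibniz
(`weightedT_sum_fderiv_mul_mul`) the sum is `W ∑_μ ∂_μ(J^T)^μ + χ(u₂/ε − 1) ∑_μ ∂_μ[χ∘u₁] (J^T)^μ
+ χ(u₁) ∑_μ ∂_μ[χ(u₂/ε − 1)] (J^T)^μ`; the first term vanishes since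
`∑_μ ∂_μ (J^T)^μ = (□Φ) ∂₀Φ + K^T` (`KerrSchild.sum_fderiv_multiplierCurrent`) with `□Φ = 0` and
`K^T = 0` (`multiplierBulk_timeField_tailsCut_eq_zero`, `T` is Killing), and the two weight terms
are `≥ 0` by `sum_fderiv_coneFactor_mul_multiplierCurrent_timeField_nonneg` (`0 ≤ φ(x) < 1`, `ℓ♯`
null with `η(ℓ♯, ∂₀) = 1`) and `tailsCut_horizonFactor_flux_nonneg`, times `χ ≥ 0`.
DRSR arXiv:1402.7034, §2.3.1–§2.3.2; Hawking–Ellis 1973, §4.3, Lemma 4.3.1. [folklore] -/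
theorem sum_fderiv_weightedTCurrent_nonneg : ∀ (M ε A : ℝ) (c : E3) (Φ : E4 → ℝ) (x : E4), 0 < M → 0 < ε → x 0 < A → 2 * M < Kerr.radius 0 x → ContDiffAt ℝ 2 Φ x → KerrSchild.waveOperator (KerrSchild.inverseMetric (fun y ↦ Real.smoothTransition (2 - Kerr.radius 0 y / (8 * M)) * (2 * Kerr.scalarH M 0 y)) (Kerr.nullVector 0)) Φ x = 0 → 0 ≤ ∑ μ, fderiv ℝ (fun y ↦ (Real.smoothTransition (Kerr.horizonFn M 0 y / ε - 1) * Real.smoothTransition (Kerr.coneFn A c y)) * KerrSchild.multiplierCurrent (KerrSchild.inverseMetric (fun z ↦ Real.smoothTransition (2 - Kerr.radius 0 z / (8 * M)) * (2 * Kerr.scalarH M 0 z)) (Kerr.nullVector 0)) KerrSchild.timeField Φ y μ) x (E4.basisVector μ) := by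
  intro M ε A c Φ x hM hε hxA hx hΦ hwave
  have hxpos : 0 < Kerr.radius 0 x := lt_trans (by positivity) hx
  have hrp : 0 < Kerr.rPlus M 0 := by
    rw [Kerr.rPlus_zero_right hM.le]
    positivity
  -- differentiability of the three factors at `x`
  have h₁ : DifferentiableAt ℝ (fun y ↦ Real.smoothTransition (Kerr.horizonFn M 0 y / ε - 1)) x :=
    (Kerr.contDiff_horizonFactor (a := 0) (n := 1) hrp hε).differentiable (by simp) x
  have h₂ : DifferentiableAt ℝ (fun y ↦ Real.smoothTransition (Kerr.coneFn A c y)) x :=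
    ((Real.smoothTransition.contDiff (n := 1)).comp (Kerr.contDiff_coneFn A c)).differentiable
      (by simp) x
  have hG : ∀ μ ν, ContDiffAt ℝ 1 (fun y ↦ KerrSchild.inverseMetric
      (fun z ↦ Real.smoothTransition (2 - Kerr.radius 0 z / (8 * M)) * (2 * Kerr.scalarH M 0 z))
      (Kerr.nullVector 0) y μ ν) x :=
    fun μ ν ↦ contDiffAt_tailsCut_inverseMetric M 0 hxpos μ ν (n := 1)
  have hX : ∀ α, ContDiffAt ℝ 1 (fun y ↦ KerrSchild.timeField y α) x :=
    fun α ↦ (KerrSchild.contDiff_timeField α).contDiffAt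
  have hJ : ∀ μ, DifferentiableAt ℝ (fun y ↦ KerrSchild.multiplierCurrent (KerrSchild.inverseMetric
      (fun z ↦ Real.smoothTransition (2 - Kerr.radius 0 z / (8 * M)) * (2 * Kerr.scalarH M 0 z))
      (Kerr.nullVector 0)) KerrSchild.timeField Φ y μ) x :=
    fun μ ↦ (KerrSchild.contDiffAt_multiplierCurrent hG hX hΦ μ).differentiableAt one_ne_zero
  -- `∑_μ ∂_μ (J^T)^μ = (□Φ) T(Φ) + K^T = 0`
  have hdiv : ∑ μ, fderiv ℝ (fun y ↦ KerrSchild.multiplierCurrent (KerrSchild.inverseMetric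
      (fun z ↦ Real.smoothTransition (2 - Kerr.radius 0 z / (8 * M)) * (2 * Kerr.scalarH M 0 z))
      (Kerr.nullVector 0)) KerrSchild.timeField Φ y μ) x (E4.basisVector μ) = 0 := by
    rw [KerrSchild.sum_fderiv_multiplierCurrent (fun μ ν ↦ (hG μ ν).differentiableAt one_ne_zero)
      (KerrSchild.inverseMetric_symm _ _ x) (fun α ↦ (hX α).differentiableAt one_ne_zero) hΦ,
      hwave, multiplierBulk_timeField_tailsCut_eq_zero M 0 Φ x hxpos, zero_mul, add_zero]
  -- the Kerr–Schild data at `x`: `0 ≤ φ < 1`, `ℓ♯` null and normalised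
  have hφ0 := weightedT_profile_nonneg hM.le 0 x
  have hφ1 := weightedT_profile_lt_one hM.le hx
  have hnull : Minkowski.bilin (Kerr.nullVector 0 x) (Kerr.nullVector 0 x) = 0 := by
    rw [Kerr.bilin_nullVector, Kerr.nullCovector_nullVector hxpos]
  have hnorm : Minkowski.bilin (Kerr.nullVector 0 x) (E4.basisVector 0) = 1 := by
    rw [Kerr.bilin_nullVector, Kerr.nullCovector_basisVector_zero]
  -- the two signed weight terms
  have hcone := sum_fderiv_coneFactor_mul_multiplierCurrent_timeField_nonneg
    (fun z ↦ Real.smoothTransition (2 - Kerr.radius 0 z / (8 * M)) * (2 * Kerr.scalarH M 0 z))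
    (Kerr.nullVector 0) Φ A c x hxA hφ0 hφ1 hnull hnorm
  have hhor := tailsCut_horizonFactor_flux_nonneg M ε Φ x hM hε hx
  have hW₁ : 0 ≤ Real.smoothTransition (Kerr.horizonFn M 0 x / ε - 1) :=
    Real.smoothTransition.nonneg _
  have hW₂ : 0 ≤ Real.smoothTransition (Kerr.coneFn A c x) := Real.smoothTransition.nonneg _
  rw [weightedT_sum_fderiv_mul_mul h₁ h₂ hJ, hdiv, mul_zero, zero_add]
  exact add_nonneg (mul_nonneg hW₁ hcone) (mul_nonneg hW₂ hhor)

/-- **The weighted Killing current of a `C²` function is `C¹` on all of `ℝ⁴`** (tails-cut zero-spin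
zone, `M > 0`, `ε > 0`): the map `y ↦ W(y) (J^T)^μ(y)`, `W = χ(u₂/ε − 1) χ(u₁)`. At points with
`r > M` every factor is `C¹` — the horizon factor is smooth on `ℝ⁴` (`Kerr.contDiff_horizonFactor`,
`r₊ = 2M > 0`), the cone factor is smooth, and the current is `C¹` since the components of `G₀`
are smooth on `{r > 0}` (`contDiffAt_tailsCut_inverseMetric`), `T` is constant and `Φ ∈ C²`
(`KerrSchild.contDiffAt_multiplierCurrent`); on `{r < 2M}` one has `u₂ ≤ 0`, so
`χ(u₂/ε − 1) = 0` and the product vanishes identically (`Kerr.contDiff_of_eq_zero_of_radius_lt`).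
[folklore] -/
theorem contDiff_weightedTCurrent : ∀ (M ε A : ℝ) (c : E3) (Φ : E4 → ℝ), 0 < M → 0 < ε → ContDiff ℝ 2 Φ → ∀ μ : Fin 4, ContDiff ℝ 1 (fun y ↦ (Real.smoothTransition (Kerr.horizonFn M 0 y / ε - 1) * Real.smoothTransition (Kerr.coneFn A c y)) * KerrSchild.multiplierCurrent (KerrSchild.inverseMetric (fun z ↦ Real.smoothTransition (2 - Kerr.radius 0 z / (8 * M)) * (2 * Kerr.scalarH M 0 z)) (Kerr.nullVector 0)) KerrSchild.timeField Φ y μ) := by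
  intro M ε A c Φ hM hε hΦ μ
  have hrp : 0 < Kerr.rPlus M 0 := by
    rw [Kerr.rPlus_zero_right hM.le]
    positivity
  refine Kerr.contDiff_of_eq_zero_of_radius_lt (a := 0) (c := 2 * M) (by positivity)
    (fun x hx ↦ ?_) (fun x hx ↦ ?_)
  · -- inside `{r < 2M}` the horizon factor vanishes
    have h1 : Kerr.horizonFn M 0 x ≤ 0 := by
      unfold Kerr.horizonFn
      rw [Kerr.rPlus_zero_right hM.le]
      exact mul_nonpos_iff.mpr (Or.inr ⟨by linarith, (Real.exp_pos _).le⟩)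
    have h2 : Kerr.horizonFn M 0 x / ε - 1 ≤ 0 := by
      have : Kerr.horizonFn M 0 x / ε ≤ 0 := div_nonpos_iff.mpr (Or.inr ⟨h1, hε.le⟩)
      linarith
    rw [Real.smoothTransition.zero_of_nonpos h2, zero_mul, zero_mul]
  · -- on `{r > M}` every factor is `C¹` at `x`
    have hxpos : 0 < Kerr.radius 0 x := lt_trans (by positivity) hx
    have hW₁ : ContDiffAt ℝ 1 (fun y ↦ Real.smoothTransition (Kerr.horizonFn M 0 y / ε - 1)) x :=
      (Kerr.contDiff_horizonFactor (a := 0) (n := 1) hrp hε).contDiffAt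
    have hW₂ : ContDiffAt ℝ 1 (fun y ↦ Real.smoothTransition (Kerr.coneFn A c y)) x :=
      ((Real.smoothTransition.contDiff (n := 1)).comp (Kerr.contDiff_coneFn A c)).contDiffAt
    have hG : ∀ μ ν, ContDiffAt ℝ 1 (fun y ↦ KerrSchild.inverseMetric
        (fun z ↦ Real.smoothTransition (2 - Kerr.radius 0 z / (8 * M)) * (2 * Kerr.scalarH M 0 z))
        (Kerr.nullVector 0) y μ ν) x :=
      fun μ ν ↦ contDiffAt_tailsCut_inverseMetric M 0 hxpos μ ν (n := 1)
    have hX : ∀ α, ContDiffAt ℝ 1 (fun y ↦ KerrSchild.timeField y α) x :=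
      fun α ↦ (KerrSchild.contDiff_timeField α).contDiffAt
    exact (hW₁.mul hW₂).mul (KerrSchild.contDiffAt_multiplierCurrent hG hX hΦ.contDiffAt μ)

end Summit.FinalStateConjecture.FinalStateConjecture.Theorems
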